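import Mathlib.Analysis.SpecialFunctions.Pow.Real
import Mathlib.Analysis.SpecialFunctions.Log.Basic
import Mathlib.Algebra.Order.Floor.Defs
import Literature.Probability.Percolation.Percolation
import HarnessLib

/-!
# Cerf 2015: two-arms events and the intermediate results behind Theorem 1.3

Statements behind `Literature.Probability.Percolation.Cerf2015_thm_1_3` (`CerfBoxLRO.lean`:
finite-box long-range order from `θ(p) > 0` for SITE percolation on `ℤ^d`). R. Cerf, *A lower bound on the two-arms exponent for critical
percolation on the lattice*, Ann. Probab. 43 (2015) 2458–2480 (arXiv:1306.3105; page numbers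
below refer to the 16-page arXiv rendering).

The proof of Theorem 1.3 (§10, p. 15) combines: the two-arms transfer inequality Lemma 7.1
(with `k = 0`), the FKG lower bound Lemma 10.1, the two-arms exponent bound Theorem 1.1 applied
at the parameter `p` (see `Cerf2015_thm_1_1_of_siteTheta_pos` for why this is legitimate), the
FKG inequality and the lattice symmetries. Theorem 1.1 in turn rests on the
Aizenman–Kesten–Newman / Gandolfi–Grimmett–Russo exploration estimate (Prop. 4.1, Hoeffding),
the central inequality (Lemma 5.1), the initial estimate (Prop. 5.2), the box two-arms bound
(Cor. 7.2), the covering argument of §8 and the exponent iteration of §9.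

This file defines Cerf's events for site percolation on `ℤ^d` and records the numbered
intermediate results as statements (`def … : Prop`); each is proved, as `<name>_holds`, in the
companion files `CerfProp41Proofs.lean`, `CerfLem51Proofs.lean`, `CerfProp52Proofs.lean`,
`CerfLem71Proofs.lean`, `CerfCor72Proofs.lean`, `CerfThm11Proofs.lean`, `CerfThm12Proofs.lean`,
`CerfTwoArmsProofs.lean` and `CerfThm13Proofs.lean`.

## Definitions (site percolation `sitePercolation (Site d) p`, graph `zdGraph d`, `Λ(n) = box d n`)

* `shiftedBox x n = x + Λ(n)`;
* `siteClusterIn G S ω x` = the open cluster of `x` in the configuration restricted to `S`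
  (p. 5: "the open clusters of the percolation configuration restricted to `Λ(n+ℓ)`");
* `siteTwoArms d x n` = `two-arms(x, n)` (p. 9): in the configuration restricted to `x + Λ(n)`,
  two neighbours of `x` are joined to `∂ⁱⁿ(x + Λ(n))` by two disjoint open clusters;
* `siteTwoArmsPair d n a b ℓ` = `two-arms(Λ(n), a, b, ℓ)` (p. 11): the open clusters of `a` and
  `b` in `Λ(n+ℓ)` are disjoint and both intersect `∂ⁱⁿΛ(n+ℓ)`;
* `siteTwoArmsBox d n ℓ` = `two-arms(Λ(n), ℓ)` (p. 12): two distinct open clusters of `Λ(n+ℓ)`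
  join `Λ(n)` to `∂ⁱⁿΛ(n+ℓ)`;
* `cerfTwoArmsExponent d = (2d² + 3d − 3)/(4d² + 5d − 5)` = `γ_∞` (p. 14).

## Faithfulness notes

* **Sign typo in Thm 1.1.** The printed conclusion `limsup (1/ln n) ln P_{p_c}(two-arms(0,n)) ≤
  (2d²+3d−3)/(4d²+5d−5)` is vacuous (`ln P ≤ 0`); the intended and proved statement (§9, and
  the displayed `d = 3` case "`∀ γ < 12/23 ∃ c ∀ n ≥ 1, P ≤ c/n^γ`") is `limsup ≤ −γ_∞`, which is
  equivalent to `∀ γ < γ_∞, ∃ c, ∀ n ≥ 1, P ≤ c · n^{−γ}` (finitely many `n` are absorbed in `c`).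
  We state the latter form.
* **Thm 1.1 at `p` with `θ(p) > 0`.** §10 (p. 15: "By theorem 1.1, for `n` large enough …")
  applies Thm 1.1 at the parameter `p` of Thm 1.3, whereas Thm 1.1 is printed at `p_c`. The
  proof of §§3–9 is written for `p ∈ ]0,1[` except Lemma 6.1 (a polynomial lower bound on
  connection probabilities at `p_c`, via `Σ_{x ∈ ∂Λ} P_{p_c}(0 ↔ x in Λ) ≥ 1`); under
  `θ(p) > 0` the same polynomial bound follows from `P(0 ↔ x_n in Λ(n)) ≥ θ(p)/|∂ⁱⁿΛ(n)|`
  (p. 15) and FKG, so §9 runs verbatim. `Cerf2015_thm_1_1_of_siteTheta_pos` records exactly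
  this used form.
* **Off-by-one in Lemma 7.1 / Cor 7.2.** The proof of Lemma 7.1 produces the event
  `two-arms(z, m)` at a closed site `z ∈ Λ(n+k+1)` and needs `z + Λ(m) ⊆ Λ(n+ℓ)`, i.e.
  `m = ℓ − k − 1`, not `ℓ − k` as printed (for `k = ℓ` the printed bound has right-hand side
  `0`, since `two-arms(0, 0) = ∅`, and is false). Since `m ↦ two-arms(0, m)` is decreasing
  (p. 14, "By monotonicity"), the versions stated here — with `two-arms(0, ℓ−k−1)` and an
  existential constant `C(d, p)` in place of `3^{4d}/p`, `3^{9d}/p` — are implied by the printed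
  statements and are what the printed proofs establish; they suffice downstream (only
  polynomial orders matter in §§8–10).
* **`n = 1` in Prop 5.2.** `κ ln 1/√1 = 0 < P(two-arms(0,1))`, so the printed `∀ n ≥ 1` must be
  read `∀ n ≥ 2` (as §9 does: "∀ n ≥ 2"). Stated with `2 ≤ n`.
* Ratios `P(·)/P(a ↔ b in Λ)` are stated multiplied out (the denominators are positive for
  `p > 0`, so nothing is lost, and no division-by-zero convention enters).
* Real box radii `n^α` are rendered `⌈n^α⌉₊`; the events are monotone in the radius in the
  direction that makes the statement given here implied by the printed one (as in
  `Cerf2015_thm_1_3`).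
-/

noncomputable section

open MeasureTheory Filter Topology Literature.Probability.LatticeModels Literature.Probability.Percolation

namespace Literature.Probability.Percolation

section CritPerc

variable {V : Type*} {d : ℕ}

/-! ### Restricted clusters and shifted boxes -/

/-- The open cluster of `x` in the site configuration `ω` restricted to `S`: the sites `y`
joined to `x` by a path of open sites of `S` (so `x, y ∈ S` open); empty if `x` is closed or
`x ∉ S`. (Cerf 2015, §2, p. 5: "the open clusters of the percolation configuration restricted
to `Λ(n+ℓ)`".) [cite: Cerf2015, §2] -/
def siteClusterIn (G : SimpleGraph V) (S : Set V) (ω : SiteConfig V) (x : V) : Set V :=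
  {y | ω ∈ siteConnIn G S x y}

/-- `y ∈ C_S(x)` iff `{x ↔ y in S}` occurs. [cite: Cerf2015, §2] -/
@[simp] theorem mem_siteClusterIn_iff (G : SimpleGraph V) (S : Set V) (ω : SiteConfig V)
    (x y : V) : y ∈ siteClusterIn G S ω x ↔ ω ∈ siteConnIn G S x y := Iff.rfl

/-- `x` lies in its own restricted cluster iff `x` is open and `x ∈ S`. [cite: Cerf2015, §2] -/
theorem mem_siteClusterIn_self_iff (G : SimpleGraph V) (S : Set V) (ω : SiteConfig V) (x : V) :
    x ∈ siteClusterIn G S ω x ↔ x ∈ ω ∧ x ∈ S := by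
  simp only [mem_siteClusterIn_iff, siteConnIn, Set.mem_setOf_eq, and_self_left]
  constructor
  · rintro ⟨hx, hS, -, -⟩
    exact ⟨hx, hS⟩
  · rintro ⟨hx, hS⟩
    exact ⟨hx, hS, hS, SimpleGraph.Reachable.refl _⟩

/-- The connection event `{x ↔ y in S}` is monotone in the region `S`. [folklore] -/
theorem siteConnIn_mono (G : SimpleGraph V) {S T : Set V} (h : S ⊆ T) (x y : V) :
    siteConnIn G S x y ⊆ siteConnIn G T x y := by
  rintro ω ⟨hx, hy, hxS, hyS, hr⟩
  refine ⟨hx, hy, h hxS, h hyS, ?_⟩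
  exact hr.map (SimpleGraph.induceHomOfLE _ h).toHom

/-- The shifted box `x + Λ(n) = {y | ‖y − x‖_∞ ≤ n}`. (Cerf 2015, p. 9, `x + Λ(n)`.) [cite: Cerf2015, §5] -/
def shiftedBox (x : Site d) (n : ℕ) : Finset (Site d) := (box d n).image fun y => x + y

/-- Membership in the shifted box. [cite: Cerf2015, §5] -/
theorem mem_shiftedBox_iff {x z : Site d} {n : ℕ} : z ∈ shiftedBox x n ↔ z - x ∈ box d n := by
  simp only [shiftedBox, Finset.mem_image]
  constructor
  · rintro ⟨y, hy, rfl⟩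
    simpa using hy
  · intro h
    exact ⟨z - x, h, by abel⟩

/-- `0 + Λ(n) = Λ(n)`. [cite: Cerf2015, §5] -/
@[simp] theorem shiftedBox_zero (n : ℕ) : shiftedBox (0 : Site d) n = box d n := by
  ext z; simp [mem_shiftedBox_iff]

/-! ### Cerf's two-arms events -/

/-- **`two-arms(x, n)`** (Cerf 2015, p. 9): "in the configuration restricted to `x + Λ(n)`, two
neighbours of `x` are connected to the boundary of the box `x + Λ(n)` by two disjoint open
clusters". Disjointness of the two (nonempty) clusters forces `x` to be closed. For `n = 0` the
event is empty. [cite: Cerf2015, §5] -/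
def siteTwoArms (d : ℕ) (x : Site d) (n : ℕ) : Set (SiteConfig (Site d)) :=
  {ω | ∃ y z : Site d, (zdGraph d).Adj x y ∧ (zdGraph d).Adj x z ∧
    Disjoint (siteClusterIn (zdGraph d) ↑(shiftedBox x n) ω y)
      (siteClusterIn (zdGraph d) ↑(shiftedBox x n) ω z) ∧
    (∃ w ∈ innerBoundary (zdGraph d) (shiftedBox x n),
      w ∈ siteClusterIn (zdGraph d) ↑(shiftedBox x n) ω y) ∧
    (∃ w ∈ innerBoundary (zdGraph d) (shiftedBox x n),
      w ∈ siteClusterIn (zdGraph d) ↑(shiftedBox x n) ω z)}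

/-- **`two-arms(Λ(n), a, b, ℓ)`** (Cerf 2015, §7, p. 11): "the open clusters of `a` and `b` in
`Λ(n+ℓ)` are disjoint and they intersect `∂ⁱⁿΛ(n+ℓ)`" (for `a, b ∈ Λ(n)`; the parameter `n`
enters only through `n + ℓ`). [cite: Cerf2015, §7] -/
def siteTwoArmsPair (d n : ℕ) (a b : Site d) (ℓ : ℕ) : Set (SiteConfig (Site d)) :=
  {ω | Disjoint (siteClusterIn (zdGraph d) ↑(box d (n + ℓ)) ω a)
      (siteClusterIn (zdGraph d) ↑(box d (n + ℓ)) ω b) ∧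
    (∃ w ∈ innerBoundary (zdGraph d) (box d (n + ℓ)),
      w ∈ siteClusterIn (zdGraph d) ↑(box d (n + ℓ)) ω a) ∧
    (∃ w ∈ innerBoundary (zdGraph d) (box d (n + ℓ)),
      w ∈ siteClusterIn (zdGraph d) ↑(box d (n + ℓ)) ω b)}

/-- **`two-arms(Λ(n), ℓ)`** (Cerf 2015, §7, p. 12): "there exist two distinct open clusters in
`Λ(n+ℓ)` joining `Λ(n)` to `∂ⁱⁿΛ(n+ℓ)`", i.e. `⋃_{a, b ∈ Λ(n)} two-arms(Λ(n), a, b, ℓ)` (proof of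
Cor. 7.2, where the union is equivalently taken over `a, b ∈ ∂ⁱⁿΛ(n)`). [cite: Cerf2015, §7] -/
def siteTwoArmsBox (d n ℓ : ℕ) : Set (SiteConfig (Site d)) :=
  {ω | ∃ a ∈ box d n, ∃ b ∈ box d n, ω ∈ siteTwoArmsPair d n a b ℓ}

/-- Unfolding of `siteTwoArmsBox`. [cite: Cerf2015, §7] -/
theorem mem_siteTwoArmsBox_iff {n ℓ : ℕ} {ω : SiteConfig (Site d)} :
    ω ∈ siteTwoArmsBox d n ℓ ↔ ∃ a ∈ box d n, ∃ b ∈ box d n, ω ∈ siteTwoArmsPair d n a b ℓ :=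
  Iff.rfl

/-- Cerf's limiting two-arms exponent `γ_∞(d) = (2d² + 3d − 3)/(4d² + 5d − 5)`, the limit of
`γ_0 = 1/2`, `γ_{i+1} = 1/2 + (d−1) γ_i/(4d² + 6d − 6)` (Cerf 2015, §9, p. 14). [cite: Cerf2015, §9] -/
def cerfTwoArmsExponent (d : ℕ) : ℝ :=
  (2 * (d : ℝ) ^ 2 + 3 * d - 3) / (4 * (d : ℝ) ^ 2 + 5 * d - 5)

/-- `γ_∞` is the fixed point of the iteration `γ ↦ 1/2 + (d−1)γ/(4d²+6d−6)` (Cerf 2015, §9). [cite: Cerf2015, §9] -/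
theorem cerfTwoArmsExponent_fixedPoint (hd : 1 ≤ d) :
    (1 : ℝ) / 2 + ((d : ℝ) - 1) * cerfTwoArmsExponent d / (4 * (d : ℝ) ^ 2 + 6 * d - 6) =
      cerfTwoArmsExponent d := by
  have hd' : (1 : ℝ) ≤ d := by exact_mod_cast hd
  have h1 : (4 * (d : ℝ) ^ 2 + 5 * d - 5) ≠ 0 := by nlinarith
  have h2 : (4 * (d : ℝ) ^ 2 + 6 * d - 6) ≠ 0 := by nlinarith
  unfold cerfTwoArmsExponent
  rw [mul_div_assoc', div_div, div_add_div _ _ two_ne_zero (mul_ne_zero h1 h2),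
    div_eq_div_iff (mul_ne_zero two_ne_zero (mul_ne_zero h1 h2)) h1]
  ring

/-- The site critical probability of `ℤ^d` at the origin as a point of `[0, 1]`
(`siteCriticalProb_mem_Icc`), so that it can be fed to `sitePercolation`. [cite: Cerf2015, §1] -/
def siteCriticalProbI (d : ℕ) : unitInterval :=
  ⟨siteCriticalProb (zdGraph d) (0 : Site d), siteCriticalProb_mem_Icc _ _⟩

/-- `siteCriticalProbI` unfolds to `siteCriticalProb`. [folklore] -/
@[simp] theorem coe_siteCriticalProbI (d : ℕ) :
    (siteCriticalProbI d : ℝ) = siteCriticalProb (zdGraph d) (0 : Site d) := rfl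

/-! ### Statements of the numbered results of Cerf 2015 (proved in the companion files) -/

/-- **Cerf 2015, Proposition 5.2** (initial two-arms estimate, from the AKN/GGR argument):
"Let `d ≥ 2` and let `p ∈ ]0,1[`. There exists a constant `κ` depending on `d` and `p` only such
that `∀ n ≥ 1, P_p(two-arms(0,n)) ≤ κ ln n/√n`." Stated for `n ≥ 2` (at `n = 1` the printed
right-hand side is `0`; §9 uses it as "∀ n ≥ 2"). [cite: Cerf2015, Prop 5.2] -/
def Cerf2015_prop_5_2 : Prop :=
  ∀ d : ℕ, 2 ≤ d → ∀ p : unitInterval, 0 < (p : ℝ) → (p : ℝ) < 1 →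
    ∃ κ : ℝ, ∀ n : ℕ, 2 ≤ n →
      (sitePercolation (Site d) p).real (siteTwoArms d 0 n) ≤ κ * Real.log n / Real.sqrt n

/-- **Cerf 2015, Lemma 7.1** (two-arms for distant sites): "Let `p ∈ ]0,1[`. For any `n, ℓ ≥ 1`
and any `a, b ∈ Λ(n)`, `∀ k ≤ ℓ, P(two-arms(Λ(n),a,b,ℓ)) ≤ (3^{4d}/p) (n+k)^{2d}
P(two-arms(0, ℓ−k)) / P(a ↔ b in Λ(n+k))`." Stated multiplied out, with an existential
constant `C(d,p)` and `two-arms(0, ℓ−k−1)` for `k + 2 ≤ ℓ` (see the module docstring: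
this is what the printed proof yields and is implied by the printed statement through the
monotonicity of `m ↦ two-arms(0, m)`). [cite: Cerf2015, Lem 7.1] -/
def Cerf2015_lem_7_1 : Prop :=
  ∀ d : ℕ, 2 ≤ d → ∀ p : unitInterval, 0 < (p : ℝ) → (p : ℝ) < 1 →
    ∃ C : ℝ, ∀ n : ℕ, 1 ≤ n → ∀ k ℓ : ℕ, k + 2 ≤ ℓ → ∀ a ∈ box d n, ∀ b ∈ box d n,
      (sitePercolation (Site d) p).real (siteTwoArmsPair d n a b ℓ) *
          (sitePercolation (Site d) p).real (siteConnIn (zdGraph d) ↑(box d (n + k)) a b) ≤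
        C * ((n : ℝ) + k) ^ (2 * d) *
          (sitePercolation (Site d) p).real (siteTwoArms d 0 (ℓ - k - 1))

/-- **Cerf 2015, Corollary 7.2** (two-arms for a box): "For any `n ≥ 1`, `ℓ ≥ n`,
`P(two-arms(Λ(n), ℓ)) ≤ (3^{9d}/p) n^{4d−2} P(two-arms(0, ℓ−n)) /
inf {P(a ↔ b in Λ(2n)) : a, b ∈ ∂ⁱⁿΛ(n)}`." Stated multiplied out against any lower bound `q`
of the infimum, with an existential constant and `two-arms(0, ℓ−n−1)` for `ℓ ≥ n + 2` (module
docstring). [cite: Cerf2015, Cor 7.2] -/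
def Cerf2015_cor_7_2 : Prop :=
  ∀ d : ℕ, 2 ≤ d → ∀ p : unitInterval, 0 < (p : ℝ) → (p : ℝ) < 1 →
    ∃ C : ℝ, ∀ n : ℕ, 1 ≤ n → ∀ ℓ : ℕ, n + 2 ≤ ℓ → ∀ q : ℝ,
      (∀ a ∈ innerBoundary (zdGraph d) (box d n), ∀ b ∈ innerBoundary (zdGraph d) (box d n),
          q ≤ (sitePercolation (Site d) p).real (siteConnIn (zdGraph d) ↑(box d (2 * n)) a b)) →
      (sitePercolation (Site d) p).real (siteTwoArmsBox d n ℓ) * q ≤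
        C * (n : ℝ) ^ (4 * d - 2) *
          (sitePercolation (Site d) p).real (siteTwoArms d 0 (ℓ - n - 1))

/-- **Cerf 2015, Theorem 1.1** (lower bound on the two-arms exponent at `p_c`): "Let `d ≥ 2`
and let `p_c` be the critical probability of the site percolation model in `d` dimensions. We
have `limsup_{n→∞} (1/ln n) ln P_{p_c}(two-arms(0,n)) ≤ (2d²+3d−3)/(4d²+5d−5)`" — read with
the intended sign, `≤ −γ_∞` (module docstring; cf. the printed `d = 3` case "`∀ γ < 12/23,
∃ c > 0, ∀ n ≥ 1, P_{p_c}(two-arms(0,n)) ≤ c/n^γ`"), in the equivalent form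
`∀ γ < γ_∞, ∃ c, ∀ n ≥ 1, P ≤ c n^{−γ}`. [cite: Cerf2015, Thm 1.1] -/
def Cerf2015_thm_1_1 : Prop :=
  ∀ d : ℕ, 2 ≤ d → ∀ γ : ℝ, γ < cerfTwoArmsExponent d →
    ∃ c : ℝ, ∀ n : ℕ, 1 ≤ n →
      (sitePercolation (Site d) (siteCriticalProbI d)).real (siteTwoArms d 0 n) ≤
        c * (n : ℝ) ^ (-γ)

/-- **Cerf 2015, Theorem 1.1 in the form used in §10** (p. 15: "We take `ℓ = n^α`. By theorem
1.1, for `n` large enough, `P(0 ↔ x_n in Λ(n + n^α)) ≥ θ(p)²/2`", at a parameter `p` with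
`θ(p) > 0`): for such `p`, `∀ γ < γ_∞, ∃ c, ∀ n ≥ 1, P_p(two-arms(0,n)) ≤ c n^{−γ}`. The proof is
§§3–9 verbatim with Lemma 6.1 replaced by the bound `P_p(0 ↔ x_n in Λ(n)) ≥ θ(p)/|∂ⁱⁿΛ(n)|`
of p. 15 (module docstring). At `p = 1` the event is null. [cite: Cerf2015, Thm 1.1 and §10 p. 15] -/
def Cerf2015_thm_1_1_of_siteTheta_pos : Prop :=
  ∀ d : ℕ, 2 ≤ d → ∀ p : unitInterval, 0 < siteTheta (zdGraph d) 0 p →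
    ∀ γ : ℝ, γ < cerfTwoArmsExponent d →
      ∃ c : ℝ, ∀ n : ℕ, 1 ≤ n →
        (sitePercolation (Site d) p).real (siteTwoArms d 0 n) ≤ c * (n : ℝ) ^ (-γ)

/-- **Cerf 2015, Theorem 1.2** (two-arms for a box at `p_c`): "Let `d ≥ 2` … Let `α` be such
that `α > (2d²+2d−2)(4d²+5d−5)/(2d²+3d−3)`. We have `lim_{n→∞} P_{p_c}(two-arms(Λ(n), n^α)) = 0`."
Rendered with `n^α ↦ ⌈n^α⌉₊` (the event decreases in the radius). [cite: Cerf2015, Thm 1.2] -/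
def Cerf2015_thm_1_2 : Prop :=
  ∀ d : ℕ, 2 ≤ d → ∀ α : ℝ,
    (2 * (d : ℝ) ^ 2 + 2 * d - 2) * (4 * (d : ℝ) ^ 2 + 5 * d - 5) /
        (2 * (d : ℝ) ^ 2 + 3 * d - 3) < α →
      Tendsto (fun n : ℕ =>
        (sitePercolation (Site d) (siteCriticalProbI d)).real
          (siteTwoArmsBox d n ⌈(n : ℝ) ^ α⌉₊)) atTop (𝓝 0)

/-- **Cerf 2015, Lemma 10.1** (connection lower bound from `θ(p)`, FKG): "Let `n, ℓ ≥ 2`. For any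
`x, y ∈ Λ(n)`, we have `P(x ↔ y in Λ(n+ℓ)) ≥ θ(p)² − P(two-arms(Λ(n), x, y, ℓ))`." Here
`θ(p) = P_p(|C(0)| = ∞) = siteTheta (zdGraph d) 0 p` (translation invariant). Valid for every
`p` (§10 assumes `θ(p) > 0` throughout, which the proof of the lemma does not use). [cite: Cerf2015, Lem 10.1] -/
def Cerf2015_lem_10_1 : Prop :=
  ∀ d : ℕ, 2 ≤ d → ∀ p : unitInterval, ∀ n ℓ : ℕ, 2 ≤ n → 2 ≤ ℓ →
    ∀ x ∈ box d n, ∀ y ∈ box d n,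
      siteTheta (zdGraph d) 0 p ^ 2 -
          (sitePercolation (Site d) p).real (siteTwoArmsPair d n x y ℓ) ≤
        (sitePercolation (Site d) p).real (siteConnIn (zdGraph d) ↑(box d (n + ℓ)) x y)

end CritPerc

end Literature.Probability.Percolation
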